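import Summits.CriticalPhenomena.PercolationContinuityZ3.Theorems.PercNearOneGluingNoHeavyLowerTailAntipodalR1TwoCut
import HarnessLib

/-!
# ANTI₁ across a cut vertex: the apex block

Support file for `stmt-CriticalPhenomena-4575` (memo `prim-gen-kcluster/KCLUSTER-gen73.md` §1.8 (B);
conjecture ANTI₁ of `KCLUSTER-gen52.md` §3).  No definitions, no named facts, no sorries.  Vocabulary of
`AntipodalR1` (`nbr`, `clus`, `freeNbr`, `region`, `lSet`, `rSet`; gen 62) and the path lemmas of
`…AntipodalR1TwoCutPaths` (gen 78) in the case `v = u` of a single shared vertex.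

Setting.  `G = A ∪ T` glued at ONE vertex `u`: the system `Sum.elim endsA endsT : ιA ⊕ ιT → Sym2 V`
with every vertex met by edges of both sides equal to `u`; the apex `a` lies on the `A` side (it is
met by edges of `T` only if `a = u`), while the terminals `b, c` are *interior* to `T` (met by some
edge of `T`, and different from `u`).

**Theorem** (`card_lSet_le_card_rSet_of_apexBlock`, the 1-sum reduction (B) of the memo):
ANTI₁ for `(T; u, b, c)` implies ANTI₁ for `(G; a, b, c)`.  Indeed (`mem_lSet_apexBlock`,
`mem_rSet_of_apexBlock`) `L(G) = M × L(T; u, b, c)` and `R(G) ⊇ M × R(T; u, b, c)` fibrewise, where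
`M = {ω_A : u ∈ O_a(A) ∩ K_a(A)}`: every path from `a` to a vertex of `T` passes through `u`
(`mem_clus_iff_of_interior`: `x ∈ clus_col(a)` in `G` iff `u ∈ clus_col(a)` in `A` and
`x ∈ clus_col(u)` in `T`, for `x` interior to `T`), and a `b–c` path avoiding `K_a ∋ u` stays inside
`T` (`region_apexBlock_iff`).  [this work]
-/

namespace Summit.CriticalPhenomena.PercolationContinuityZ3.Theorems

namespace AntipodalR1

open Finset Relation

variable {V ιA ιT : Type*}

section Paths

variable {endsA : ιA → Sym2 V} {endsT : ιT → Sym2 V} {u a : V} {ω : ιA ⊕ ιT → Bool}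

/-- With a single shared vertex the jumps of the reduced adjacency are loops at `u`: reduced
reachability is reachability in the near side alone. [this work] -/
theorem red_path_loop_iff {ωA : ιA → Bool} {J : Bool → Prop} {col : Bool} {p q : V} :
    ReflTransGen (fun p q => q ∈ nbr endsA ωA col p ∨ (J col ∧ (p = u ∧ q = u ∨ p = u ∧ q = u))) p q ↔
      q ∈ clus endsA ωA col p := by
  rw [mem_clus]
  constructor
  · intro h
    induction h with
    | refl => exact ReflTransGen.refl
    | tail _ hst ih =>
      rcases hst with hn | ⟨_, hpq⟩
      · exact ih.tail hn
      · rcases hpq with ⟨rfl, rfl⟩ | ⟨rfl, rfl⟩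
        · exact ih
        · exact ih
  · exact path_mono fun _ _ h => Or.inl h

/-- **Near side.**  At a vertex `x` of the apex side (met by edges of `T` only if `x = u`), the
`col`-cluster of `a` in `G = A ∪_u T` is that of `A` alone. [this work] -/
theorem mem_clus_iff_of_cutVertex
    (hsep : ∀ w i, w ∈ endsA i → ∀ j, w ∈ endsT j → w = u) (ha : ∀ j, a ∈ endsT j → a = u)
    {col : Bool} {x : V} (hx : ∀ j, x ∈ endsT j → x = u) :
    x ∈ clus (Sum.elim endsA endsT) ω col a ↔ x ∈ clus endsA (fun i => ω (Sum.inl i)) col a := by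
  rw [mem_clus_iff_red (J := fun c => u ∈ clus endsT (fun j => ω (Sum.inr j)) c u)
    (fun w i hw j hj => Or.inl (hsep w i hw j hj)) (fun j hj => Or.inl (ha j hj)) Iff.rfl
    (fun j hj => Or.inl (hx j hj)),
    red_path_loop_iff (J := fun c => u ∈ clus endsT (fun j => ω (Sum.inr j)) c u) (col := col)]

/-- **Far side.**  At a vertex `x` interior to `T` (met by an edge of `T`, `x ≠ u`), `x` lies in the
`col`-cluster of `a` in `G = A ∪_u T` iff `u` does in `A` and `x` lies in the `col`-cluster of `u` in
`T`: every path from `a` into `T` passes through `u`. [this work] -/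
theorem mem_clus_iff_of_interior
    (hsep : ∀ w i, w ∈ endsA i → ∀ j, w ∈ endsT j → w = u) (ha : ∀ j, a ∈ endsT j → a = u)
    {col : Bool} {x : V} (hxT : ∃ j, x ∈ endsT j) (hxu : x ≠ u) :
    x ∈ clus (Sum.elim endsA endsT) ω col a ↔
      u ∈ clus endsA (fun i => ω (Sum.inl i)) col a ∧
        x ∈ clus endsT (fun j => ω (Sum.inr j)) col u := by
  constructor
  · intro h
    have hxI : ¬ ∀ j, x ∈ endsT j → x = u ∨ x = u :=
      fun h' => hxT.elim fun j hj => hxu ((h' j hj).elim id id)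
    obtain ⟨w, hw, haw, hxw⟩ := (red_of_clus (fun w i hw j hj => Or.inl (hsep w i hw j hj))
      (fun j hj => Or.inl (ha j hj)) h).2 hxI
    have hwu : w = u := hw.elim id id
    rw [hwu] at haw hxw
    exact ⟨(red_path_loop_iff (J := fun c => u ∈ clus endsT (fun j => ω (Sum.inr j)) c u)
      (col := col)).1 haw, hxw⟩
  · rintro ⟨hu, hxu'⟩
    exact mem_clus.2 ((mem_clus.1 (clus_inl_subset hu)).trans (mem_clus.1 (clus_inr_subset hxu')))

/-- A vertex met by an edge of `T` is `u` or interior to `T`; in either case, if `u ∉ K_a(A)` then it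
avoids `K_a(G)`. [this work] -/
theorem not_mem_clus_of_touch
    (hsep : ∀ w i, w ∈ endsA i → ∀ j, w ∈ endsT j → w = u) (ha : ∀ j, a ∈ endsT j → a = u)
    {col : Bool} (huA : u ∉ clus endsA (fun i => ω (Sum.inl i)) col a) {x : V} (hxT : ∃ j, x ∈ endsT j) :
    x ∉ clus (Sum.elim endsA endsT) ω col a := by
  intro hx
  by_cases hxu : x = u
  · subst hxu
    exact huA ((mem_clus_iff_of_cutVertex hsep ha (fun _ _ => rfl)).1 hx)
  · exact huA ((mem_clus_iff_of_interior hsep ha hxT hxu).1 hx).1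

/-- If `u ∉ K_a(A)`, a coloured path of `T` from `u` is a support path of `G` avoiding `K_a(G)`.
[this work] -/
theorem freePath_of_clusT
    (hsep : ∀ w i, w ∈ endsA i → ∀ j, w ∈ endsT j → w = u) (ha : ∀ j, a ∈ endsT j → a = u)
    (huA : u ∉ clus endsA (fun i => ω (Sum.inl i)) false a)
    {col : Bool} {x : V} (hxT : ∃ j, x ∈ endsT j) (hx : x ∈ clus endsT (fun j => ω (Sum.inr j)) col u) :
    ReflTransGen (fun p q => q ∈ freeNbr (Sum.elim endsA endsT) ω a p) u x := by
  rw [mem_clus] at hx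
  induction hx with
  | refl => exact ReflTransGen.refl
  | @tail y z hy hyz ih =>
    obtain ⟨j, _, he⟩ := hyz
    have hyT : ∃ j, y ∈ endsT j := ⟨j, by rw [he]; exact Sym2.mem_mk_left _ _⟩
    have hzT : ∃ j, z ∈ endsT j := ⟨j, by rw [he]; exact Sym2.mem_mk_right _ _⟩
    exact (ih hyT).tail ⟨⟨Sum.inr j, he⟩, not_mem_clus_of_touch hsep ha huA hyT,
      not_mem_clus_of_touch hsep ha huA hzT⟩

/-- **Regions.**  If `u ∈ K_a(A)` and `b` is interior to `T`: a vertex is joined to `b` avoiding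
`K_a(G)` in `G` iff it is joined to `b` avoiding `K_u(T)` in `T`. [this work] -/
theorem region_apexBlock_iff {b x : V}
    (hsep : ∀ w i, w ∈ endsA i → ∀ j, w ∈ endsT j → w = u) (ha : ∀ j, a ∈ endsT j → a = u)
    (huA : u ∈ clus endsA (fun i => ω (Sum.inl i)) false a) (hbT : ∃ j, b ∈ endsT j) (hbu : b ≠ u) :
    x ∈ region (Sum.elim endsA endsT) ω a b ↔ x ∈ region endsT (fun j => ω (Sum.inr j)) u b := by
  have huG : u ∈ clus (Sum.elim endsA endsT) ω false a :=
    (mem_clus_iff_of_cutVertex hsep ha (fun _ _ => rfl)).2 huA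
  -- a vertex met by an edge of `T` and avoiding `K_a(G)` is interior and avoids `K_u(T)`
  have down : ∀ {z : V} (j : ιT), z ∈ endsT j → z ∉ clus (Sum.elim endsA endsT) ω false a →
      z ≠ u ∧ z ∉ clus endsT (fun j => ω (Sum.inr j)) false u := by
    intro z j hj hzK
    have hzu : z ≠ u := fun h => hzK (h ▸ huG)
    exact ⟨hzu, fun h => hzK ((mem_clus_iff_of_interior hsep ha ⟨j, hj⟩ hzu).2 ⟨huA, h⟩)⟩
  -- a vertex met by an edge of `T` and avoiding `K_u(T)` avoids `K_a(G)`
  have up : ∀ {z : V} (j : ιT), z ∈ endsT j → z ∉ clus endsT (fun j => ω (Sum.inr j)) false u →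
      z ∉ clus (Sum.elim endsA endsT) ω false a := by
    intro z j hj hzK hzK'
    by_cases hzu : z = u
    · subst hzu; exact hzK ReflTransGen.refl
    · exact hzK ((mem_clus_iff_of_interior hsep ha ⟨j, hj⟩ hzu).1 hzK').2
  rw [mem_region, mem_region]
  constructor
  · intro hx
    suffices h : (∃ j, x ∈ endsT j) ∧ x ≠ u ∧
        ReflTransGen (fun p q => q ∈ freeNbr endsT (fun j => ω (Sum.inr j)) u p) b x from h.2.2
    induction hx with
    | refl => exact ⟨hbT, hbu, ReflTransGen.refl⟩
    | @tail y z _ hyz ih =>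
      obtain ⟨⟨e, he⟩, hyK, hzK⟩ := hyz
      obtain ⟨⟨j₀, hj₀⟩, hyu, hby⟩ := ih
      cases e with
      | inl i =>
        -- an edge of `A` at the interior vertex `y` of `T`: impossible
        exact (hyu (hsep y i (by rw [show endsA i = s(y, z) from he]; exact Sym2.mem_mk_left _ _)
          j₀ hj₀)).elim
      | inr j =>
        have he' : endsT j = s(y, z) := he
        have hzj : z ∈ endsT j := by rw [he']; exact Sym2.mem_mk_right _ _
        have hyj : y ∈ endsT j := by rw [he']; exact Sym2.mem_mk_left _ _
        obtain ⟨hzu, hzK'⟩ := down j hzj hzK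
        exact ⟨⟨j, hzj⟩, hzu, hby.tail ⟨⟨j, he'⟩, (down j hyj hyK).2, hzK'⟩⟩
  · intro hx
    induction hx with
    | refl => exact ReflTransGen.refl
    | @tail y z _ hyz ih =>
      obtain ⟨⟨j, he⟩, hyK, hzK⟩ := hyz
      have hzj : z ∈ endsT j := by rw [he]; exact Sym2.mem_mk_right _ _
      have hyj : y ∈ endsT j := by rw [he]; exact Sym2.mem_mk_left _ _
      exact ih.tail ⟨⟨Sum.inr j, he⟩, up j hyj hyK, up j hzj hzK⟩

end Paths

section Sets

variable {endsA : ιA → Sym2 V} {endsT : ιT → Sym2 V} {u a b c : V}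
variable [Fintype ιA] [DecidableEq ιA] [Fintype ιT] [DecidableEq ιT]

/-- **`L(G) = M × L(T; u, b, c)` (forward inclusion, fibrewise).**  For `b, c` interior to `T`:
if `ω_A ⊕ ω_T ∈ L(G; a, b, c)` then `u ∈ O_a(A) ∩ K_a(A)` and `ω_T ∈ L(T; u, b, c)`. [this work] -/
theorem mem_lSet_apexBlock
    (hsep : ∀ w i, w ∈ endsA i → ∀ j, w ∈ endsT j → w = u) (ha : ∀ j, a ∈ endsT j → a = u)
    (hbT : ∃ j, b ∈ endsT j) (hbu : b ≠ u) (hcT : ∃ j, c ∈ endsT j) (hcu : c ≠ u)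
    {ωA : ιA → Bool} {ωT : ιT → Bool} (h : Sum.elim ωA ωT ∈ lSet (Sum.elim endsA endsT) a b c) :
    (u ∈ clus endsA ωA true a ∧ u ∈ clus endsA ωA false a) ∧ ωT ∈ lSet endsT u b c := by
  classical
  obtain ⟨hOb, hKb, hOc, hKc, hbc⟩ := (mem_filter.1 h).2
  have hOb' := (mem_clus_iff_of_interior (ω := Sum.elim ωA ωT) hsep ha hbT hbu).1 hOb
  have hOc' := (mem_clus_iff_of_interior (ω := Sum.elim ωA ωT) hsep ha hcT hcu).1 hOc
  -- `u ∈ K_a(A)`: otherwise `b` and `c` are joined through `u` avoiding `K_a(G)`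
  have huK : u ∈ clus endsA ωA false a := by
    by_contra huK
    refine hbc (mem_region.2 ?_)
    exact (region_symm (freePath_of_clusT (ω := Sum.elim ωA ωT) hsep ha huK hbT hOb'.2)).trans
      (freePath_of_clusT (ω := Sum.elim ωA ωT) hsep ha huK hcT hOc'.2)
  refine ⟨⟨hOb'.1, huK⟩, mem_filter.2 ⟨mem_univ _, hOb'.2, fun h' => hKb
    ((mem_clus_iff_of_interior hsep ha hbT hbu).2 ⟨huK, h'⟩), hOc'.2, fun h' => hKc
    ((mem_clus_iff_of_interior hsep ha hcT hcu).2 ⟨huK, h'⟩), fun h' => hbc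
    ((region_apexBlock_iff (ω := Sum.elim ωA ωT) hsep ha huK hbT hbu).2 h')⟩⟩

/-- **`R(G) ⊇ M × R(T; u, b, c)` (fibrewise).**  For `b, c` interior to `T`: if
`u ∈ O_a(A) ∩ K_a(A)` and `ω_T ∈ R(T; u, b, c)` then `ω_A ⊕ ω_T ∈ R(G; a, b, c)`. [this work] -/
theorem mem_rSet_of_apexBlock
    (hsep : ∀ w i, w ∈ endsA i → ∀ j, w ∈ endsT j → w = u) (ha : ∀ j, a ∈ endsT j → a = u)
    (hbT : ∃ j, b ∈ endsT j) (hbu : b ≠ u) (hcT : ∃ j, c ∈ endsT j) (hcu : c ≠ u)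
    {ωA : ιA → Bool} {ωT : ιT → Bool} (huO : u ∈ clus endsA ωA true a)
    (huK : u ∈ clus endsA ωA false a) (h : ωT ∈ rSet endsT u b c) :
    Sum.elim ωA ωT ∈ rSet (Sum.elim endsA endsT) a b c := by
  classical
  obtain ⟨hOb, hKb, hKc, hOc⟩ := (mem_filter.1 h).2
  exact mem_filter.2 ⟨mem_univ _,
    (mem_clus_iff_of_interior (ω := Sum.elim ωA ωT) hsep ha hbT hbu).2 ⟨huO, hOb⟩,
    fun h' => hKb ((mem_clus_iff_of_interior (ω := Sum.elim ωA ωT) hsep ha hbT hbu).1 h').2,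
    (mem_clus_iff_of_interior (ω := Sum.elim ωA ωT) hsep ha hcT hcu).2 ⟨huK, hKc⟩,
    fun h' => hOc ((mem_clus_iff_of_interior (ω := Sum.elim ωA ωT) hsep ha hcT hcu).1 h').2⟩

/-- Fibre decomposition over the colouring of the FIRST summand. [this work] -/
theorem card_eq_sum_card_fibre_left (S : Finset (ιA ⊕ ιT → Bool)) :
    S.card = ∑ ω₁ : ιA → Bool, (univ.filter fun ω₂ : ιT → Bool => Sum.elim ω₁ ω₂ ∈ S).card := by
  classical
  have hS : (S.card : ℕ) = ∑ ω : ιA ⊕ ιT → Bool, if ω ∈ S then 1 else 0 := by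
    rw [Finset.sum_boole, Nat.cast_id, Finset.filter_mem_eq_inter, Finset.univ_inter]
  rw [hS, ← Fintype.sum_equiv (⟨fun p => Sum.elim p.1 p.2,
      fun ω => (fun i => ω (Sum.inl i), fun j => ω (Sum.inr j)),
      fun p => rfl, fun ω => funext fun e => by cases e <;> rfl⟩ :
        (ιA → Bool) × (ιT → Bool) ≃ (ιA ⊕ ιT → Bool))
      (fun p => if Sum.elim p.1 p.2 ∈ S then 1 else 0) _ (fun p => rfl),
    Fintype.sum_prod_type]
  refine Finset.sum_congr rfl fun ω₁ _ => ?_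
  rw [Finset.sum_boole, Nat.cast_id]

/-- **The 1-sum reduction, apex block** (memo `KCLUSTER-gen73` §1.8 (B), kernel form).  Let
`G = A ∪ T` be glued at the single vertex `u` (every vertex met by edges of both sides is `u`), the
apex `a` met by edges of `T` only if `a = u`, and the terminals `b, c` interior to `T` (met by an edge
of `T`, different from `u`).  Then ANTI₁ for `(T; u, b, c)` implies ANTI₁ for `(G; a, b, c)`.  No other
hypothesis on `A` or `T`. [this work] -/
theorem card_lSet_le_card_rSet_of_apexBlock (endsA : ιA → Sym2 V) (endsT : ιT → Sym2 V)
    (u a b c : V)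
    (hsep : ∀ w i, w ∈ endsA i → ∀ j, w ∈ endsT j → w = u) (ha : ∀ j, a ∈ endsT j → a = u)
    (hbT : ∃ j, b ∈ endsT j) (hbu : b ≠ u) (hcT : ∃ j, c ∈ endsT j) (hcu : c ≠ u)
    (h0 : (lSet endsT u b c).card ≤ (rSet endsT u b c).card) :
    (lSet (Sum.elim endsA endsT) a b c).card ≤ (rSet (Sum.elim endsA endsT) a b c).card := by
  classical
  rw [card_eq_sum_card_fibre_left (lSet _ a b c), card_eq_sum_card_fibre_left (rSet _ a b c)]
  refine sum_le_sum fun ωA _ => ?_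
  by_cases hM : u ∈ clus endsA ωA true a ∧ u ∈ clus endsA ωA false a
  · calc (univ.filter fun ω₂ : ιT → Bool =>
          Sum.elim ωA ω₂ ∈ lSet (Sum.elim endsA endsT) a b c).card
        ≤ (lSet endsT u b c).card := card_le_card fun ωT h =>
          (mem_lSet_apexBlock hsep ha hbT hbu hcT hcu (mem_filter.1 h).2).2
      _ ≤ (rSet endsT u b c).card := h0
      _ ≤ (univ.filter fun ω₂ : ιT → Bool =>
          Sum.elim ωA ω₂ ∈ rSet (Sum.elim endsA endsT) a b c).card :=
          card_le_card fun ωT h => mem_filter.2 ⟨mem_univ _,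
            mem_rSet_of_apexBlock hsep ha hbT hbu hcT hcu hM.1 hM.2 h⟩
  · have h00 : (univ.filter fun ω₂ : ιT → Bool =>
        Sum.elim ωA ω₂ ∈ lSet (Sum.elim endsA endsT) a b c) = ∅ :=
      filter_eq_empty_iff.2 fun ωT _ h => hM (mem_lSet_apexBlock hsep ha hbT hbu hcT hcu h).1
    rw [h00, card_empty]
    exact Nat.zero_le _

end Sets

end AntipodalR1

end Summit.CriticalPhenomena.PercolationContinuityZ3.Theorems
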